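import Literature.AlgebraicGeometry.Resolution.MonomialMarkedIdealsBlowup
import Literature.AlgebraicGeometry.Resolution.MonomialOrderReductionUnit
import Literature.AlgebraicGeometry.Resolution.MarkedIdealsArithmetic
import Mathlib.RingTheory.RegularLocalRing.Defs
import HarnessLib

/-!
# [OURS · L1 W4.5(b) · EL♮(3)] HSUB(ReachTC⁺) — OFF THE CENTRE A POINT BLOW-UP DOES NOT CHANGE THE QUOTIENT STALKS OF THE CARRIER
# PAIR (registered stub `stub_elnat_tcPlusPointResolution`; brick K7c, clause (v) of `TCPlus.Member` at the special points NOT over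
# the stepped point)

Crux `EquisingularLiftNat` = stmt-ResolutionOfSingularities-20038 (child EL♮(3) = stmt-ResolutionOfSingularities-20148), route
EquisingularLift, line `sections`. Helper file `--supports stmt-ResolutionOfSingularities-20148 --as helper` by res-L1-w45b-stub-1
(HSUB(ReachTC⁺) assembly). HONEST FRAMING: OURS (cell res-hironaka, slot W4.5(b)); folklore blow-up bookkeeping, NOT a statement of
any manuscript; AI-written, weaker than expert review. No `sorry`; standard axioms.

* `stalkIdeal_carrierStrictTransform_of_not_mem_support` — off `V(C)`: `(St 𝓢 ⊔ St K)_z = τ^♯_z ((𝓢 ⊔ K)_{τ z})`;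
* **`nonempty_quotient_carrierStrictTransform_ringEquiv_of_not_mem_support`** — off `V(C)` the quotient stalk
  `𝒪_{X',z} ⧸ (St 𝓢 ⊔ St K)_z` is isomorphic to `𝒪_{X,τ z} ⧸ (𝓢 ⊔ K)_{τ z}` (`τ^♯_z` is an isomorphism, Stacks 02OS);
* `isRegularLocalRing_quotient_carrierStrictTransform_of_not_mem_support` — so regularity and the dimension of the quotient stalk
  are those downstairs.

References: [cite: StacksProject, Tag 02OS]; [cite: GortzWedhorn2020, Prop. 13.91 (3)].
-/

set_option linter.dupNamespace false -- mandated namespace `Summit.<Summit>.<Problem>` of this single-conjunct summit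

noncomputable section

open CategoryTheory AlgebraicGeometry TopologicalSpace IsLocalRing
open Literature.AlgebraicGeometry.Resolution
open AlgebraicGeometry.Scheme.IdealSheafData

namespace Summit.ResolutionOfSingularities.ResolutionOfSingularities.Cruxes.EquisingularLiftNat.Sections

universe u

variable {X X' : Scheme.{u}} [IsLocallyNoetherian X'] {τ : X' ⟶ X} {C : X.IdealSheafData}

/-- Off the centre, the stalk of `St 𝓢 ⊔ St K` is the image of the stalk of `𝓢 ⊔ K`. [cite: StacksProject, Tag 02OS] -/
theorem stalkIdeal_carrierStrictTransform_of_not_mem_support (𝓢 K : X.IdealSheafData) {z : X'} (hz : τ z ∉ C.support) :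
    stalkIdeal (strictTransformIdeal τ C 𝓢 ⊔ strictTransformIdeal τ C K) z =
      (stalkIdeal (𝓢 ⊔ K) (τ z)).map (τ.stalkMap z).hom := by
  rw [stalkIdeal_sup, stalkIdeal_sup, Ideal.map_sup, stalkIdeal_strictTransformIdeal_of_not_mem_support C 𝓢 hz,
    stalkIdeal_strictTransformIdeal_of_not_mem_support C K hz]

/-- **Off the centre the quotient stalks of the carrier pair do not change.** For a blow-up `τ` of `C` and `z ∈ X'` with
`τ z ∉ V(C)`: `𝒪_{X',z} ⧸ (St 𝓢 ⊔ St K)_z ≅ 𝒪_{X,τ z} ⧸ (𝓢 ⊔ K)_{τ z}`. [cite: StacksProject, Tag 02OS] [OURS · L1 W4.5b] brick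
K7c toward `stub_elnat_tcPlusPointResolution`; NOT a statement of the manuscript. -/
theorem nonempty_quotient_carrierStrictTransform_ringEquiv_of_not_mem_support (hτ : IsBlowup τ C) (𝓢 K : X.IdealSheafData)
    {z : X'} (hz : τ z ∉ C.support) :
    Nonempty ((X.presheaf.stalk (τ z) ⧸ stalkIdeal (𝓢 ⊔ K) (τ z)) ≃+*
      (X'.presheaf.stalk z ⧸ stalkIdeal (strictTransformIdeal τ C 𝓢 ⊔ strictTransformIdeal τ C K) z)) := by
  haveI : IsIso (τ.stalkMap z) := hτ.isIso_stalkMap_of_not_mem_support hz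
  let e : X.presheaf.stalk (τ z) ≃+* X'.presheaf.stalk z := (asIso (τ.stalkMap z)).commRingCatIsoToRingEquiv
  refine ⟨Ideal.quotientEquiv _ _ e ?_⟩
  rw [stalkIdeal_carrierStrictTransform_of_not_mem_support 𝓢 K hz]
  rfl

/-- Off the centre: regularity and dimension of the quotient stalk of `St 𝓢 ⊔ St K` are those of `𝓢 ⊔ K` downstairs.
[cite: StacksProject, Tag 02OS] -/
theorem isRegularLocalRing_quotient_carrierStrictTransform_of_not_mem_support (hτ : IsBlowup τ C) (𝓢 K : X.IdealSheafData)
    {z : X'} (hz : τ z ∉ C.support) (hreg : IsRegularLocalRing (X.presheaf.stalk (τ z) ⧸ stalkIdeal (𝓢 ⊔ K) (τ z))) :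
    IsRegularLocalRing (X'.presheaf.stalk z ⧸ stalkIdeal (strictTransformIdeal τ C 𝓢 ⊔ strictTransformIdeal τ C K) z) ∧
      ringKrullDim (X'.presheaf.stalk z ⧸ stalkIdeal (strictTransformIdeal τ C 𝓢 ⊔ strictTransformIdeal τ C K) z) =
        ringKrullDim (X.presheaf.stalk (τ z) ⧸ stalkIdeal (𝓢 ⊔ K) (τ z)) := by
  obtain ⟨e⟩ := nonempty_quotient_carrierStrictTransform_ringEquiv_of_not_mem_support hτ 𝓢 K hz
  exact ⟨IsRegularLocalRing.of_ringEquiv e, (ringKrullDim_eq_of_ringEquiv e).symm⟩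

omit [IsLocallyNoetherian X'] in
/-- Off the centre the local rings themselves do not change: `dim 𝒪_{X',z} = dim 𝒪_{X,τ z}`. [cite: StacksProject, Tag 02OS] -/
theorem ringKrullDim_stalk_eq_of_not_mem_support (hτ : IsBlowup τ C) {z : X'} (hz : τ z ∉ C.support) :
    ringKrullDim (X'.presheaf.stalk z) = ringKrullDim (X.presheaf.stalk (τ z)) := by
  haveI : IsIso (τ.stalkMap z) := hτ.isIso_stalkMap_of_not_mem_support hz
  exact (ringKrullDim_eq_of_ringEquiv (asIso (τ.stalkMap z)).commRingCatIsoToRingEquiv).symm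

end Summit.ResolutionOfSingularities.ResolutionOfSingularities.Cruxes.EquisingularLiftNat.Sections

end
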